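import Mathlib.Algebra.BigOperators.Intervals
import Mathlib.Algebra.BigOperators.Group.List.Basic
import Mathlib.Algebra.Field.Basic
import Mathlib.Tactic.Ring
import HarnessLib

/-!
# The characters `Char`, `dChar` of the shuffle algebra (Panzer 2022, §2.5), I: definitions

The summand of the Hepp bound of an ordering `σ` is `dChar` of the word of increments of the
superficial degree of convergence (Panzer 2022, §2.5 [Panzer2022]):
`dChar(s₁,…,s_N) = 1/(s₁ (s₁+s₂) ⋯ (s₁+⋯+s_{N-1}))`, `Char(s₁,…,s_k) = 1/(s₁ (s₁+s₂) ⋯ (s₁+⋯+s_k))`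
(eqs. before Prop. 2.24), and the two facts driving every identity of the Hepp bound are
**Prop. 2.24** (`Char` is multiplicative on shuffles: `Char(a ⧢ b) = Char(a) Char(b)`, "symmetral
moulds", Rem. 2.25) and **Lemma 2.23** (`dChar(v ⧢ w) = 0` when `|v| + |w| = 0`); both are
proved in `ShuffleCharMultiplicative.lean` (pointwise in a field wherever the partial sums
occurring are non-zero; the source proves them as identities of rational functions in the
letters). This light file only sets up the characters.

We read words from the right: `suffixChar w = Char(w.reverse)` is the product of the inverses of
the non-empty SUFFIX sums, which is structurally recursive in the first letter and matches the
first-letter recursion `(a u) ⧢ (b v) = a (u ⧢ b v) + b (a u ⧢ v)` of the tree's shuffle product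
`MZV.shuffleWord` (`Literature/NumberTheory/Transcendental/MZVWordShuffle.lean`, reused, not
redefined); Panzer's `Char` itself is `prefixChar`, and `dChar(w) = Char(w.dropLast)` becomes
`suffixChar (w.tail)` on reversed words. Reversal is an involution of the set of shuffles, so the
two readings are equivalent; the Hepp-bound application (flag formula Prop. 3.2, vanishing
Thm 2.19 in `HeppBound.lean`) may read orderings backwards (`reverse_mem_orderings`).

## Contents (namespace `Literature.Combinatorics.Matroid`)

* `suffixChar`, `prefixChar` (= Panzer's `Char`, with `prefixChar_eq_prod` unfolding it to
  `Π_k (s₁+⋯+s_k)⁻¹`), `SuffixSumsNeZero`.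
-/

namespace Literature.Combinatorics.Matroid

variable {𝕜 : Type*} [Field 𝕜]

/-! ### `Char` read from the right -/

/-- `suffixChar (s₁, …, s_n) = Π_{k=1}^{n} (s_k + s_{k+1} + ⋯ + s_n)⁻¹`: Panzer's character `Char`
(§2.5, display before Prop. 2.24) of the REVERSED word, defined by the first-letter recursion
`suffixChar (a w) = (a + Σ w)⁻¹ · suffixChar w`, `suffixChar [] = 1`. [cite: Panzer2022, §2.5 (Char)] -/
def suffixChar : List 𝕜 → 𝕜
  | [] => 1
  | a :: w => ((a :: w).sum)⁻¹ * suffixChar w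

/-- `suffixChar [] = 1` (the empty word, `Char([]) := 1`). [cite: Panzer2022, §2.5 (Char)] -/
@[simp] theorem suffixChar_nil : suffixChar ([] : List 𝕜) = 1 := rfl

/-- The recursion `suffixChar (a w) = (a + Σ w)⁻¹ · suffixChar w`. [cite: Panzer2022, §2.5 (Char)] -/
@[simp] theorem suffixChar_cons (a : 𝕜) (w : List 𝕜) :
    suffixChar (a :: w) = (a + w.sum)⁻¹ * suffixChar w := by
  rw [suffixChar, List.sum_cons]

/-- **Panzer's `Char`**: `prefixChar (s₁, …, s_k) = 1/(s₁ (s₁+s₂) ⋯ (s₁+⋯+s_k))` (§2.5, the display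
defining `Char`), realised as `suffixChar` of the reversed word. [cite: Panzer2022, §2.5 (Char)] -/
def prefixChar (w : List 𝕜) : 𝕜 :=
  suffixChar w.reverse

/-- `Char([]) = 1`. [cite: Panzer2022, §2.5 (Char)] -/
@[simp] theorem prefixChar_nil : prefixChar ([] : List 𝕜) = 1 := rfl

/-- The last-letter recursion `Char(w α) = Char(w) · (|w| + α)⁻¹` used in the proof of Prop. 2.24
("expand `Char(aα) = (|a|+α) Char(a)`"). [cite: Panzer2022, Prop. 2.24 (proof)] -/
theorem prefixChar_concat (w : List 𝕜) (a : 𝕜) :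
    prefixChar (w ++ [a]) = (w.sum + a)⁻¹ * prefixChar w := by
  rw [prefixChar, List.reverse_append, List.reverse_singleton, List.singleton_append,
    suffixChar_cons, List.sum_reverse, add_comm, prefixChar]

/-- Unfolding `prefixChar` to Panzer's product of inverse prefix sums
`Π_{k=1}^{|w|} (s₁ + ⋯ + s_k)⁻¹`. [cite: Panzer2022, §2.5 (Char)] -/
theorem prefixChar_eq_prod (w : List 𝕜) :
    prefixChar w = ∏ k ∈ Finset.range w.length, ((w.take (k + 1)).sum)⁻¹ := by
  induction w using List.reverseRecOn with
  | nil => simp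
  | append_singleton w a ih =>
    rw [prefixChar_concat, ih, List.length_append, List.length_singleton,
      Finset.prod_range_succ, mul_comm]
    congr 1
    · refine Finset.prod_congr rfl fun k hk => ?_
      rw [Finset.mem_range] at hk
      rw [List.take_append_of_le_length (by omega)]
    · rw [List.take_of_length_le (by simp), List.sum_append, List.sum_singleton]

/-- All non-empty suffix sums of `w` are non-zero: the pointwise non-degeneracy under which the
rational-function identities of §2.5 may be evaluated. [folklore] -/
def SuffixSumsNeZero (w : List 𝕜) : Prop :=
  ∀ t : List 𝕜, t <:+ w → t ≠ [] → t.sum ≠ 0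

/-- Suffixes of `w` are suffixes of `a :: w`. [folklore] -/
theorem SuffixSumsNeZero.of_cons {a : 𝕜} {w : List 𝕜} (h : SuffixSumsNeZero (a :: w)) :
    SuffixSumsNeZero w :=
  fun t ht hne => h t (ht.trans (List.suffix_cons a w)) hne

/-- The full sum of a non-empty word with non-vanishing suffix sums is non-zero. [folklore] -/
theorem SuffixSumsNeZero.sum_ne_zero {w : List 𝕜} (h : SuffixSumsNeZero w) (hw : w ≠ []) :
    w.sum ≠ 0 :=
  h w (List.suffix_refl w) hw

end Literature.Combinatorics.Matroid
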